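import Summits.QuantumFields.BalabanUV.T4Continuum.Support.NE7OneStepOfLocalChartWideDecSlice
import Summits.QuantumFields.BalabanUV.T4Continuum.Support.NE7OneStepOfLocalChartRatio
import HarnessLib

/-!
# GEN 99 RE-THREAD (`…Slice`, Bałaban-slice road, memo `t4/b2b-balaban-t4-ne7-p1-g99/ROAD-G99.md` §3.5 ∕ §3.8): this file is `NE7OneStepOfLocalChartRatioWideDec`'s CHAIN THEOREM VERBATIM except that
# the slice `T_♮(U♯) = frameFreeBlockLandauW` of the per-pair binder is replaced by an ABSTRACT SLICE FAMILY `𝒯 k U♯` with the two hypotheses (hT) «tangent-critical ⟹ critical on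
# `𝒯 j W`» and (hP) «class SlicePoincare for `𝒯 j W`» in the generic theorems, and by the corner-free energy block-Landau slice `𝒯_E = energyBlockLandauW` (both hypotheses
# DISCHARGED: `hT_energyBlockLandau`, `classSlicePoincare_energyBlockLandau_SU2`, constant `8·CPLine 4 2 2 10⁻¹⁷ 10⁻⁵³ + 1`) in the SU(2) `d = 4` `L = 2` theorems; chain predecessors are
# the `…Slice` ∕ `…GenericSlice` re-issues (lineage `b2b-balaban-t4-ne7-p1` gen 99, CRUX PROVER NE7 #1).  NOT NE7; spine 0∕9.  Original docstring follows.

# GEN 95 RE-THREAD (`…Dec`): this file is `NE7OneStepOfLocalChartRatioWide` VERBATIM except that F31's per-pair binder `hleaves` (row NE3's weight currency,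
# numerically refuted for arbitrary pairs — memo `t4/b2b-balaban-t4-ne7-p1-g95/WEIGHT-CURRENCY-DEAD.md`) is replaced by F327's honest binder `hdecomp`
# (decomposition `X = X_T + X_N` with its two energy letters and k-free currencies `(α̂, ν̂, κ̂)`) and route Π's uniform block by ONE k-free line;
# the chart∕budget content is untouched and chain predecessors are the `…Dec` re-issues.  Original docstring follows.

# NE7 — ONE-STEP from the local chart ON THE WIDE COVER in the regime, GENERAL RATIO `δ = λε` (F284cw)

[Balaban1985Variational] Prop 8 ∘ [Balaban1983Laplace] Thm 2, row NE7.  F284c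
`NE7OneStepOfLocalChartRatio.oneStep_of_chart_regime_ratio` VERBATIM except that the chart hypothesis is
asked on the `Kc`-fold cover for a FREE `Kc ≥ 4ℓ + 12` (over F283w `NE7OneStepOfLocalChartWide`) instead of
the `(4ℓ+12)`-fold cover, on which for small `N` the chart ball is the whole torus and the hypothesis is
refuted by torons (gen 91, `NE7LocalChartCoverObstruction.not_chart_cover12`); the consumer takes
`Kc ≥ 2·nbRad (d+1) L + 4ℓ + 24`, making the chart LOCAL.  Ratio `0 < λ < 1` (`δ = λε`, `δ₁ = λε/2`,
`θ = 1/4`, `c₀ = λε/4`); the budget is discharged by F284c's letters (`budgetC_of_regime_ratio`).  Bill: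
THE CHART (constants `≤ A(ℓ+1)^p`, small field `r ≤ λε`), row NE3's `hleaves` (at `δ₁ = λε/2`),
`LevelSmall`, slice Poincaré, route Π's two `k`-free lines.
-/

open scoped BigOperators Matrix Matrix.Norms.L2Operator Topology
open NormedSpace Finset Set Filter

namespace Summit.QuantumFields.BalabanUV.T4Continuum.NE7OneStepOfLocalChartRatioWideDecSlice

open Literature.MathematicalPhysics.QuantumFieldTheory.Balaban1983to89
open B7Prop1Explicit B7Prop2Explicit MatrixLog UnitaryModel
open B4TorusKernel.MultiPeriod (torusSupNorm)
open T4AveragingDeficitWall (IsUnitaryCfg IsSkewDir SmallField vary curl curlSq dirSq dirL1)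
open T4AveragingDeficitWallBoundary (IsPeriodicCfg periodBox)
open AveragingDeficitPeriodicCounting (IsPeriodicDir)
open AveragingDeficitMultiLevelPrep (LevelSmall tower TangentIter)
open BlockAverageVaryHolo (nbRad)
open BlockAverageVaryDisc (rho0 rho0_pos)
open MinimalActionLevels (perWin)
open MinimalActionSandwich (IsMinimiser admissible)
open MinimalActionRate (sfClass)
open NE3HessForm (dAction)
open NE3SlicePoincareShape (SlicePoincare)
open NE7MeanZeroGaugeSliceW (energyBlockLandauW)
open NE7EnergyBlockLandauClassPoincare (classSlicePoincare_energyBlockLandau_SU2)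
open NE7ConvOneStepGenericSlice (hT_energyBlockLandau)
open NE3TangentCovariantTower (dirIter)
open NE3DecomposedRepOfLinearNormalPart (ResidualSliceRepT)
open NE3QbarIterCovLiftPrep (cruxC)
open NE3SmoothRightInverseW (rightInvW)
open NE3RightInverseSolveLetters (thetaLoc)
open NE3RightInverseL2Letter (l2C)
open NE3HatInvCurlLetters (curl2C curl1C curl1C_nonneg)
open B4Sect5Proof (latticeConst latticeConst_nonneg)
open B5Hk163Strip (kappa163 kappa163_pos)
open B5Hk163TorusHolderDecay (CdecD CdecD_nonneg)
open NE3EnergyShapes (IsUnitarySite)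
open BlockAveragePushDirSplit (flat)
open NE7OneStepOfLocalChartWideDecSlice (oneStep_of_dataClass_chart_routePi_wide)
open T4AveragingDeficitWall (Plaq)
open NE3EnergyWeightedShapes (energyNormW)
open NE7OneStepOfLocalChartRatio (budgetC_of_regime_ratio)
open NE7TorusRoadBudgetLetters (At_le Ab_le budgetR_of_regime growth_Y growth_Z)
open NE7OneStepOfLocalChartRegime (tendsto_succ_pow_mul_exp_neg)
open NE7TorusRoadLine (consts_nonneg)

variable {d : ℕ} {n : Type*} [Fintype n] [DecidableEq n]

set_option maxHeartbeats 800000 in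
/-- **F284cw — the small-field ONE-STEP from the local chart on the WIDE cover, regime of ratio `λ = δ/ε`.**
[Balaban1985Variational] Prop 8 ∘ [Balaban1983Laplace] Thm 2, rows NE7 ∘ NE3: F284c's statement with a free
cover factor `Kc ≥ 4ℓ + 12` (the chart hypothesis at period `N·Kc`); proof = F284c's over F283w. -/
theorem oneStep_of_chart_regime_ratio_wide [Nonempty n] {L : ℕ} [NeZero L] (hL : 2 ≤ L) {A : ℝ} (hA : 0 ≤ A) (p : ℕ)
    {lam : ℝ} (hl0 : 0 < lam) (hl1 : lam < 1) :
    ∃ ℓ : ℕ, 1 ≤ ℓ ∧ ∃ ε₀ : ℝ, 0 < ε₀ ∧ ∀ ε : ℝ, 0 < ε → ε ≤ ε₀ → ∃ β₀ : ℝ, 0 < β₀ ∧ ∀ β : ℝ, 0 < β → β ≤ β₀ →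
    ∀ (N : ℕ) [NeZero N] (Kc : ℕ) (CP C₀ C₁ αh νh κh : ℝ), 1 ≤ N → 4 * ℓ + 12 ≤ Kc → 0 < CP →
    (∀ k : ℕ, LevelSmall (d + 1) L k (ε / ((L : ℝ) ^ (k + 1)) ^ 2)) →
    ∀ (𝒯 : ℕ → (Site (d + 1) → Fin (d + 1) → (Matrix n n ℂ)ˣ) → Set (Site (d + 1) → Fin (d + 1) → Matrix n n ℂ)),
    (∀ (j : ℕ) (W : Site (d + 1) → Fin (d + 1) → (Matrix n n ℂ)ˣ), W ∈ sfClass (d + 1) L N ε (j + 1) → ∀ F : Finset (Plaq (d + 1)),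
      (∀ φ : Site (d + 1) → Fin (d + 1) → Matrix n n ℂ, IsSkewDir φ → IsPeriodicDir φ ((tower L N (j + 1) : ℕ) : ℤ) → TangentIter L j W φ → dAction W φ F = 0) →
      ∀ Y ∈ 𝒯 j W, dAction W Y F = 0) →
    (∀ (j : ℕ) (W : Site (d + 1) → Fin (d + 1) → (Matrix n n ℂ)ˣ), W ∈ sfClass (d + 1) L N ε (j + 1) → SlicePoincare L (j + 1) W (𝒯 j W) CP (periodBox (d := d + 1) (N * L ^ (j + 1)))) →
    -- the k-free ceilings `(α̂, ν̂, κ̂)` of the honest per-pair binder and ONE k-free strict line (F327)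
    2 * κh < ((((1 / 2 - νh ^ 2) / (2 * (1 + CP)) - νh ^ 2) / 2 - 576 * ((d + 1 : ℕ) : ℝ) * (αh ^ 2 * Real.exp (2 * αh))) / (Fintype.card n : ℝ) - 28 * ((d + 1 : ℕ) : ℝ) * (ε + 7 * αh ^ 2)) →
    -- the chart constants, polynomial in `ℓ + 1`
    0 ≤ C₀ → C₀ ≤ A * ((ℓ : ℝ) + 1) ^ p → 0 ≤ C₁ → C₁ ≤ A * ((ℓ : ℝ) + 1) ^ p →
    -- THE CHART (N1)-weak at `δ = λε`: [B8] Thm 2 at `U₀ = 1` on nested cubes, TYPE (asserted for nothing here)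
    (∀ D : Site (d + 1) → Fin (d + 1) → (Matrix n n ℂ)ˣ, IsUnitaryCfg D → IsPeriodicCfg D ((N * Kc) : ℤ) → SmallField D (4 * (Real.exp β - 1)) →
      ∀ (k : ℕ), ∀ U ∈ admissible (sfClass (d + 1) L (N * Kc) ε) L (k + 1) D,
      (∀ φ : Site (d + 1) → Fin (d + 1) → Matrix n n ℂ, IsSkewDir φ → IsPeriodicDir φ (((N * Kc) * L ^ (k + 1) : ℕ) : ℤ) → TangentIter L k U φ →
        dAction U φ (perWin (d + 1) ((N * Kc) * L ^ (k + 1))) = 0) →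
      ∀ r : ℝ, 0 ≤ r → r ≤ (lam * ε) → SmallField U (r / ((L : ℝ) ^ (k + 1)) ^ 2) →
      ∀ z : Site (d + 1), ∃ (u : Site (d + 1) → (Matrix n n ℂ)ˣ) (At : Site (d + 1) → Fin (d + 1) → Matrix n n ℂ) (a₀ a₁ : ℝ),
        IsUnitarySite u ∧ (∀ (y : Site (d + 1)) (i : Fin (d + 1)), u (y + (((N * Kc) * L ^ (k + 1) : ℕ) : ℤ) • e i) = u y) ∧
        IsSkewDir At ∧ IsPeriodicDir At (((N * Kc) * L ^ (k + 1) : ℕ) : ℤ) ∧ 0 ≤ a₀ ∧ 0 ≤ a₁ ∧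
        (∀ (y : Site (d + 1)) (κ : Fin (d + 1)), ‖At y κ‖ ≤ a₀) ∧ (∀ (y : Site (d + 1)) (κ τ : Fin (d + 1)), ‖At (y + e τ) κ - At y κ‖ ≤ a₁) ∧
        (L : ℝ) ^ (k + 1) * a₀ ≤ C₀ * (r + 4 * (Real.exp β - 1) + ε) ∧ ((L : ℝ) ^ (k + 1)) ^ 2 * a₁ ≤ C₁ * (r + 4 * (Real.exp β - 1) + ε) ∧
        (∀ (y : Site (d + 1)) (κ : Fin (d + 1)),
          torusSupNorm (fun _ : Fin (d + 1) => L ^ (k + 1) * (N * Kc)) (y - z) ≤ (((nbRad (d + 1) L + 2 * ℓ + 10) * L ^ (k + 1) : ℕ) : ℝ) →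
            gaugeAct u U y κ = vary (flat (d := d + 1) (n := n)) At 1 y κ)) →
    -- THE HONEST PER-PAIR BINDER `hdecomp` on the data class at `δ₁ = λε/2` (F327's, dimension `d + 1`)
    (∀ D : Site (d + 1) → Fin (d + 1) → (Matrix n n ℂ)ˣ, IsUnitaryCfg D → IsPeriodicCfg D (N : ℤ) → SmallField D (4 * (Real.exp β - 1)) → ∀ (k : ℕ), ∀ Us ∈ admissible (sfClass (d + 1) L N ε) L (k + 1) D, SmallField Us ((lam * ε / 2) / ((L : ℝ) ^ (k + 1)) ^ 2) → (∀ φ : Site (d + 1) → Fin (d + 1) → Matrix n n ℂ, IsSkewDir φ → IsPeriodicDir φ ((N * L ^ (k + 1) : ℕ) : ℤ) → TangentIter L k Us φ → dAction Us φ (perWin (d + 1) (N * L ^ (k + 1))) = 0) → ∀ U' ∈ admissible (sfClass (d + 1) L N ε) L (k + 1) D, 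
      ∃ (u : Site (d + 1) → (Matrix n n ℂ)ˣ) (X XT XN : Site (d + 1) → Fin (d + 1) → Matrix n n ℂ) (α ν κ : ℝ),
        IsUnitarySite u ∧ IsSkewDir X ∧ IsPeriodicDir X ((N * L ^ (k + 1) : ℕ) : ℤ) ∧ 0 ≤ α ∧ (∀ x μ, ‖X x μ‖ ≤ α) ∧
        gaugeAct u U' = vary Us X 1 ∧
        X = XT + XN ∧ XT ∈ 𝒯 k Us ∧ IsSkewDir XN ∧ 0 ≤ ν ∧
        energyNormW L (k + 1) Us XN (periodBox (d := d + 1) (N * L ^ (k + 1)))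
          ≤ ν * energyNormW L (k + 1) Us X (periodBox (d := d + 1) (N * L ^ (k + 1))) ∧
        ε / ((L : ℝ) ^ (k + 1)) ^ 2 * (∑ p ∈ perWin (d + 1) (N * L ^ (k + 1)), ‖curl Us XN p‖)
          ≤ κ * energyNormW L (k + 1) Us X (periodBox (d := d + 1) (N * L ^ (k + 1))) ^ 2 ∧
        α * (L : ℝ) ^ (k + 1) ≤ αh ∧ ν ≤ νh ∧ κ ≤ κh) →
    ∃ γ : ℝ, 0 < γ ∧ ∀ V : Site (d + 1) → Fin (d + 1) → (Matrix n n ℂ)ˣ, IsUnitaryCfg V → IsPeriodicCfg V (N : ℤ) → SmallField V γ →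
      ∀ (k : ℕ) (U₀ : Site (d + 1) → Fin (d + 1) → (Matrix n n ℂ)ˣ), U₀ ∈ admissible (sfClass (d + 1) L N ε) L (k + 1) V →
        SmallField U₀ ((lam * ε) / ((L : ℝ) ^ k) ^ 2) →
        ∃ U, IsMinimiser (d + 1) (sfClass (d + 1) L N ε) L N (k + 1) V U ∧ SmallField U ((lam * ε) / ((L : ℝ) ^ (k + 1)) ^ 2) := by
  obtain ⟨K, c, hK, hc, hF⟩ := oneStep_of_dataClass_chart_routePi_wide (d := d) (n := n) hL
  obtain ⟨hKd0, hCg0, hK30, hK40, hD0, -⟩ := consts_nonneg (d := d) L 0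
  have hcP0 : (0 : ℝ) ≤ (Fintype.card (T4AveragingDeficitWall.Plane (d + 1)) : ℝ) := Nat.cast_nonneg _
  have hnF0 : (0 : ℝ) ≤ (Fintype.card n : ℝ) := Nat.cast_nonneg _
  have hCd0 : (0 : ℝ) ≤ CdecD d := CdecD_nonneg
  have hkap : (0 : ℝ) < kappa163 (d + 1) / (d + 1) / 2 := by have := kappa163_pos (d + 1); positivity
  have hlc0 : (0 : ℝ) ≤ latticeConst (d + 1) (kappa163 (d + 1) / (d + 1) / 2) := latticeConst_nonneg _ hkap.le
  have hcurl : (0 : ℝ) ≤ curl1C (d + 1) L := curl1C_nonneg _ _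
  have hCcs0 : (0 : ℝ) ≤ (2 * curl1C (d + 1) L) := mul_nonneg zero_le_two hcurl
  have hρ : (0 : ℝ) < rho0 (d + 1) L := rho0_pos (d := d + 1) (le_trans one_le_two hL)
  have hA1 : (0 : ℝ) ≤ A + 1 := by linarith only [hA]
  have hL0 : (0 : ℝ) ≤ (L : ℝ) := Nat.cast_nonneg _
  have hD10 : (0 : ℝ) ≤ (((d + 1 : ℕ) : ℝ) + 1) := by positivity
  -- the two growth constants and the two decays
  have hQb00 : (0 : ℝ) ≤ (28 * ((3 + 12 * ((d + 1 : ℕ) : ℝ)) + (4 * (3 + 12 * ((d + 1 : ℕ) : ℝ)) ^ 3 / rho0 (d + 1) L ^ 2) * (A + 1)) ^ 2 + 4 * (4 * (3 + 12 * ((d + 1 : ℕ) : ℝ)) ^ 3 / rho0 (d + 1) L ^ 2)) := add_nonneg (mul_nonneg (by norm_num) (sq_nonneg _)) (mul_nonneg (by norm_num) hK40)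
  have hY0 : (0 : ℝ) ≤ (K * (2 * curl1C (d + 1) L) + 8 * K * (Fintype.card (T4AveragingDeficitWall.Plane (d + 1)) : ℝ) * (A + 1)) :=
    add_nonneg (mul_nonneg hK hCcs0) (mul_nonneg (mul_nonneg (mul_nonneg (by norm_num) hK) hcP0) hA1)
  have hZ0 : (0 : ℝ) ≤ (2 * (Fintype.card n : ℝ) * CdecD d * ((d : ℝ) + 1) * latticeConst (d + 1) (kappa163 (d + 1) / (d + 1) / 2) * ((3 + 12 * ((d + 1 : ℕ) : ℝ)) * (A + 1) + ((d : ℝ) + 1) * 6 * (2 * (3 + 12 * ((d + 1 : ℕ) : ℝ)) * (A + 1) + (28 * ((3 + 12 * ((d + 1 : ℕ) : ℝ)) + (4 * (3 + 12 * ((d + 1 : ℕ) : ℝ)) ^ 3 / rho0 (d + 1) L ^ 2) * (A + 1)) ^ 2 + 4 * (4 * (3 + 12 * ((d + 1 : ℕ) : ℝ)) ^ 3 / rho0 (d + 1) L ^ 2)) * (A + 1) ^ 2))) :=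
    mul_nonneg (mul_nonneg (mul_nonneg (mul_nonneg (mul_nonneg zero_le_two hnF0) hCd0) hD0) hlc0)
      (add_nonneg (mul_nonneg hK30 hA1) (mul_nonneg (mul_nonneg hD0 (by norm_num))
        (add_nonneg (mul_nonneg (mul_nonneg zero_le_two hK30) hA1) (mul_nonneg hQb00 (pow_nonneg hA1 2)))))
  have hηY : (0 : ℝ) < lam / (72 * ((K * (2 * curl1C (d + 1) L) + 8 * K * (Fintype.card (T4AveragingDeficitWall.Plane (d + 1)) : ℝ) * (A + 1)) + 1)) := div_pos hl0 (by linarith only [hY0])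
  have hηZ : (0 : ℝ) < lam / (72 * ((2 * (Fintype.card n : ℝ) * CdecD d * ((d : ℝ) + 1) * latticeConst (d + 1) (kappa163 (d + 1) / (d + 1) / 2) * ((3 + 12 * ((d + 1 : ℕ) : ℝ)) * (A + 1) + ((d : ℝ) + 1) * 6 * (2 * (3 + 12 * ((d + 1 : ℕ) : ℝ)) * (A + 1) + (28 * ((3 + 12 * ((d + 1 : ℕ) : ℝ)) + (4 * (3 + 12 * ((d + 1 : ℕ) : ℝ)) ^ 3 / rho0 (d + 1) L ^ 2) * (A + 1)) ^ 2 + 4 * (4 * (3 + 12 * ((d + 1 : ℕ) : ℝ)) ^ 3 / rho0 (d + 1) L ^ 2)) * (A + 1) ^ 2))) + 1)) := div_pos hl0 (by linarith only [hZ0])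
  have eY := (tendsto_succ_pow_mul_exp_neg p hc).eventually_le_const hηY
  have eZ := (tendsto_succ_pow_mul_exp_neg (4 * p + 1) hkap).eventually_le_const hηZ
  obtain ⟨ℓ, hℓ1, hℓu, hℓv⟩ := ((eventually_ge_atTop 1).and (eY.and eZ)).exists
  -- the cube parameter `ℓ`
  refine ⟨ℓ, hℓ1, ?_⟩
  have hℓr : (1 : ℝ) ≤ (ℓ : ℝ) := Nat.one_le_cast.mpr hℓ1
  have hx1 : (1 : ℝ) ≤ ((ℓ : ℝ) + 1) := by linarith only [hℓr]
  have hx0 : (0 : ℝ) ≤ ((ℓ : ℝ) + 1) := by linarith only [hℓr]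
  have hlq0 : (0 : ℝ) ≤ (4 * ((ℓ + 1 : ℕ) : ℝ) + 2) := by positivity
  have hlqx : (4 * ((ℓ + 1 : ℕ) : ℝ) + 2) ≤ 6 * ((ℓ : ℝ) + 1) := by push_cast; linarith only [hℓr]
  have hxp0 : (0 : ℝ) ≤ ((ℓ : ℝ) + 1) ^ p := pow_nonneg hx0 p
  have hec0 : (0 : ℝ) ≤ Real.exp (-(c * ℓ)) := (Real.exp_pos _).le
  have hec1 : Real.exp (-(c * ℓ)) ≤ 1 := Real.exp_le_one_iff.mpr (neg_nonpos.mpr (mul_nonneg hc.le (Nat.cast_nonneg ℓ)))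
  have hek0 : (0 : ℝ) ≤ Real.exp (-(kappa163 (d + 1) / (d + 1) / 2 * ℓ)) := (Real.exp_pos _).le
  have hek1 : Real.exp (-(kappa163 (d + 1) / (d + 1) / 2 * ℓ)) ≤ 1 := Real.exp_le_one_iff.mpr (neg_nonpos.mpr (mul_nonneg hkap.le (Nat.cast_nonneg ℓ)))
  -- growth bounds at `ℓ` (explicit forms), then LETTERS for the big constants
  have aY := mul_le_mul_of_nonneg_left (growth_Y (p := p) (A := A) hK hCcs0 hcP0 hx1) hec0
  have aZ := mul_le_mul_of_nonneg_left (growth_Z (p := p) hK30 hK40 hCd0 hD0 hlc0 hnF0 hA hx1 hlqx) hek0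
  obtain ⟨Cb, hCb⟩ : ∃ t : ℝ, t = (A * ((ℓ : ℝ) + 1) ^ p + 1) := ⟨_, rfl⟩
  rw [← hCb] at aY aZ
  have hCb1 : (1 : ℝ) ≤ Cb := by rw [hCb]; exact le_add_of_nonneg_left (mul_nonneg hA hxp0)
  have hCb0 : (0 : ℝ) ≤ Cb := zero_le_one.trans hCb1
  have hQb0 : (0 : ℝ) ≤ (28 * ((3 + 12 * ((d + 1 : ℕ) : ℝ)) + (4 * (3 + 12 * ((d + 1 : ℕ) : ℝ)) ^ 3 / rho0 (d + 1) L ^ 2) * Cb) ^ 2 + 4 * (4 * (3 + 12 * ((d + 1 : ℕ) : ℝ)) ^ 3 / rho0 (d + 1) L ^ 2)) :=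
    add_nonneg (mul_nonneg (by norm_num) (sq_nonneg _)) (mul_nonneg (by norm_num) hK40)
  obtain ⟨Xs, hXs⟩ : ∃ t : ℝ, t = (4 * K * (2 * curl1C (d + 1) L) * (8 * (3 + 12 * ((d + 1 : ℕ) : ℝ)) * (2 + 2 * ((((d + 1 : ℕ) : ℝ) + 1) * L)
        * (1 + ((1250 * ((nbRad (d + 1) L : ℝ) + L) + 8 * (((d + 1 : ℕ) : ℝ) * L) + 2 * L) * (((d + 1 : ℕ) : ℝ) * (2 * nbRad (d + 1) L + 1) ^ (d + 1)))
          / ((L : ℝ) / (L : ℝ) ^ (d + 1))))) * Cb + (53392 * K * (Fintype.card (T4AveragingDeficitWall.Plane (d + 1)) : ℝ) * Cb ^ 4 + (Fintype.card n : ℝ) * (2 * (CdecD d * (((d : ℝ) + 1) * (2 * ((d : ℝ) + 1))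
              * ((2 + 32 / (kappa163 (d + 1) / (d + 1)) ^ 2) * latticeConst (d + 1) (kappa163 (d + 1) / (d + 1) / 2))))) * (1 + 12 * ((d : ℝ) + 1)) * (28 * ((3 + 12 * ((d + 1 : ℕ) : ℝ)) + (4 * (3 + 12 * ((d + 1 : ℕ) : ℝ)) ^ 3 / rho0 (d + 1) L ^ 2) * Cb) ^ 2 + 4 * (4 * (3 + 12 * ((d + 1 : ℕ) : ℝ)) ^ 3 / rho0 (d + 1) L ^ 2)) * Cb ^ 2 + 28 * Cb ^ 2)) := ⟨_, rfl⟩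
  obtain ⟨Z, hZ⟩ : ∃ t : ℝ, t = (2 * (Fintype.card n : ℝ) * CdecD d * ((d : ℝ) + 1) * latticeConst (d + 1) (kappa163 (d + 1) / (d + 1) / 2) * ((3 + 12 * ((d + 1 : ℕ) : ℝ)) * Cb + ((d : ℝ) + 1) * (4 * ((ℓ + 1 : ℕ) : ℝ) + 2) * (2 * (3 + 12 * ((d + 1 : ℕ) : ℝ)) * Cb + (28 * ((3 + 12 * ((d + 1 : ℕ) : ℝ)) + (4 * (3 + 12 * ((d + 1 : ℕ) : ℝ)) ^ 3 / rho0 (d + 1) L ^ 2) * Cb) ^ 2 + 4 * (4 * (3 + 12 * ((d + 1 : ℕ) : ℝ)) ^ 3 / rho0 (d + 1) L ^ 2)) * Cb ^ 2))) := ⟨_, rfl⟩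
  obtain ⟨G, hG⟩ : ∃ t : ℝ, t = ((Fintype.card n : ℝ) * (2 * (CdecD d * (((d : ℝ) + 1) * (2 * ((d : ℝ) + 1))
              * ((2 + 32 / (kappa163 (d + 1) / (d + 1)) ^ 2) * latticeConst (d + 1) (kappa163 (d + 1) / (d + 1) / 2))))) * (1 + 12 * ((d : ℝ) + 1)) + 2 * (Fintype.card n : ℝ) * CdecD d * ((d : ℝ) + 1) * ((d : ℝ) + 1) * latticeConst (d + 1) (kappa163 (d + 1) / (d + 1) / 2) * (4 * ((ℓ + 1 : ℕ) : ℝ) + 2)) := ⟨_, rfl⟩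
  rw [← hZ] at aZ
  have hXs0 : (0 : ℝ) ≤ Xs := by
    rw [hXs]
    exact add_nonneg (mul_nonneg (mul_nonneg (mul_nonneg (mul_nonneg (by norm_num) hK) hCcs0) hKd0) hCb0)
      (add_nonneg (add_nonneg (mul_nonneg (mul_nonneg (mul_nonneg (by norm_num) hK) hcP0) (pow_nonneg hCb0 4))
        (mul_nonneg (mul_nonneg (mul_nonneg (mul_nonneg hnF0 hCg0) (by linarith only [hD0])) hQb0) (pow_nonneg hCb0 2)))
        (mul_nonneg (by norm_num) (pow_nonneg hCb0 2)))
  have hGB0 : (0 : ℝ) ≤ G := by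
    rw [hG]
    exact add_nonneg (mul_nonneg (mul_nonneg hnF0 hCg0) (by linarith only [hD0]))
      (mul_nonneg (mul_nonneg (mul_nonneg (mul_nonneg (mul_nonneg (mul_nonneg zero_le_two hnF0) hCd0) hD0) hD0) hlc0) hlq0)
  have hYx : Real.exp (-(c * ℓ)) * (K * (2 * curl1C (d + 1) L) + 8 * K * (Fintype.card (T4AveragingDeficitWall.Plane (d + 1)) : ℝ) * Cb) ≤ lam / 72 := by
    have b := mul_le_mul_of_nonneg_left hℓu hY0
    have c' : (K * (2 * curl1C (d + 1) L) + 8 * K * (Fintype.card (T4AveragingDeficitWall.Plane (d + 1)) : ℝ) * (A + 1)) * (lam / (72 * ((K * (2 * curl1C (d + 1) L) + 8 * K * (Fintype.card (T4AveragingDeficitWall.Plane (d + 1)) : ℝ) * (A + 1)) + 1))) ≤ lam / 72 := by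
      rw [← mul_div_assoc, div_le_div_iff₀ (by linarith only [hY0]) (by norm_num)]; nlinarith only [hY0, hl0]
    linarith only [aY, b, c']
  have hZx : Real.exp (-(kappa163 (d + 1) / (d + 1) / 2 * ℓ)) * Z ≤ lam / 72 := by
    have b := mul_le_mul_of_nonneg_left hℓv hZ0
    have c' : (2 * (Fintype.card n : ℝ) * CdecD d * ((d : ℝ) + 1) * latticeConst (d + 1) (kappa163 (d + 1) / (d + 1) / 2) * ((3 + 12 * ((d + 1 : ℕ) : ℝ)) * (A + 1) + ((d : ℝ) + 1) * 6 * (2 * (3 + 12 * ((d + 1 : ℕ) : ℝ)) * (A + 1) + (28 * ((3 + 12 * ((d + 1 : ℕ) : ℝ)) + (4 * (3 + 12 * ((d + 1 : ℕ) : ℝ)) ^ 3 / rho0 (d + 1) L ^ 2) * (A + 1)) ^ 2 + 4 * (4 * (3 + 12 * ((d + 1 : ℕ) : ℝ)) ^ 3 / rho0 (d + 1) L ^ 2)) * (A + 1) ^ 2))) * (lam / (72 * ((2 * (Fintype.card n : ℝ) * CdecD d * ((d : ℝ) + 1) * latticeConst (d + 1) (kappa163 (d + 1) / (d + 1) / 2)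 * ((3 + 12 * ((d + 1 : ℕ) : ℝ)) * (A + 1) + ((d : ℝ) + 1) * 6 * (2 * (3 + 12 * ((d + 1 : ℕ) : ℝ)) * (A + 1) + (28 * ((3 + 12 * ((d + 1 : ℕ) : ℝ)) + (4 * (3 + 12 * ((d + 1 : ℕ) : ℝ)) ^ 3 / rho0 (d + 1) L ^ 2) * (A + 1)) ^ 2 + 4 * (4 * (3 + 12 * ((d + 1 : ℕ) : ℝ)) ^ 3 / rho0 (d + 1) L ^ 2)) * (A + 1) ^ 2))) + 1))) ≤ lam / 72 := by
      rw [← mul_div_assoc, div_le_div_iff₀ (by linarith only [hZ0]) (by norm_num)]; nlinarith only [hZ0, hl0]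
    linarith only [aZ, b, c']
  -- `ε₀ = 1 / M`
  have n2 : (0 : ℝ) ≤ 3 := by norm_num
  have nCb2 : (0 : ℝ) ≤ 3 * Cb := by linarith only [hCb0]
  have nρ : (0 : ℝ) ≤ 12 * (3 + 12 * ((d + 1 : ℕ) : ℝ)) ^ 2 * Cb / rho0 (d + 1) L ^ 2 :=
    div_nonneg (mul_nonneg (mul_nonneg (by norm_num) (sq_nonneg _)) hCb0) (sq_nonneg _)
  have nKd : (0 : ℝ) ≤ 3 * (8 * (3 + 12 * ((d + 1 : ℕ) : ℝ)) * (2 + 2 * ((((d + 1 : ℕ) : ℝ) + 1) * L)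
        * (1 + ((1250 * ((nbRad (d + 1) L : ℝ) + L) + 8 * (((d + 1 : ℕ) : ℝ) * L) + 2 * L) * (((d + 1 : ℕ) : ℝ) * (2 * nbRad (d + 1) L + 1) ^ (d + 1)))
          / ((L : ℝ) / (L : ℝ) ^ (d + 1))))) * Cb := mul_nonneg (mul_nonneg (by norm_num) hKd0) hCb0
  have nD1 : (0 : ℝ) ≤ 768 * (((d + 1 : ℕ) : ℝ) + 1) * L * (3 + 12 * ((d + 1 : ℕ) : ℝ)) * Cb :=
    mul_nonneg (mul_nonneg (mul_nonneg (mul_nonneg (by norm_num) hD10) hL0) hK30) hCb0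
  have nθ : (0 : ℝ) ≤ 2 * |thetaLoc (d + 1) L| := mul_nonneg zero_le_two (abs_nonneg _)
  have nX : (0 : ℝ) ≤ 216 * Xs / lam := div_nonneg (mul_nonneg (by norm_num) hXs0) hl0.le
  have ncx : (0 : ℝ) ≤ |cruxC (d + 1) L| + 1 := by linarith only [abs_nonneg (cruxC (d + 1) L)]
  have nc0 : (0 : ℝ) ≤ 6 * |C0 (d + 1)| := mul_nonneg (by norm_num) (abs_nonneg _)
  have nH2 : (0 : ℝ) ≤ 1024 * (((d + 1 : ℕ) : ℝ) + 1) * (((d + 1 : ℕ) : ℝ) + 4) * (L : ℝ) ^ 2 := mul_nonneg (mul_nonneg (mul_nonneg (by norm_num) hD10) (by positivity)) (sq_nonneg _)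
  have hM : (0 : ℝ) < (3 + 3 * Cb + 12 * (3 + 12 * ((d + 1 : ℕ) : ℝ)) ^ 2 * Cb / rho0 (d + 1) L ^ 2 + 3 * (8 * (3 + 12 * ((d + 1 : ℕ) : ℝ)) * (2 + 2 * ((((d + 1 : ℕ) : ℝ) + 1) * L)
        * (1 + ((1250 * ((nbRad (d + 1) L : ℝ) + L) + 8 * (((d + 1 : ℕ) : ℝ) * L) + 2 * L) * (((d + 1 : ℕ) : ℝ) * (2 * nbRad (d + 1) L + 1) ^ (d + 1)))
          / ((L : ℝ) / (L : ℝ) ^ (d + 1))))) * Cb + 768 * (((d + 1 : ℕ) : ℝ) + 1) * L * (3 + 12 * ((d + 1 : ℕ) : ℝ)) * Cb + 2 * |thetaLoc (d + 1) L| + 216 * Xs / lam + |cruxC (d + 1) L| + 6 * |C0 (d + 1)| + 1024 * (((d + 1 : ℕ) : ℝ) + 1) * (((d + 1 : ℕ) : ℝ) + 4) * (L : ℝ) ^ 2 + 1) := by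
    linarith only [n2, nCb2, nρ, nKd, nD1, nθ, nX, ncx, nc0, nH2]
  refine ⟨1 / (3 + 3 * Cb + 12 * (3 + 12 * ((d + 1 : ℕ) : ℝ)) ^ 2 * Cb / rho0 (d + 1) L ^ 2 + 3 * (8 * (3 + 12 * ((d + 1 : ℕ) : ℝ)) * (2 + 2 * ((((d + 1 : ℕ) : ℝ) + 1) * L)
        * (1 + ((1250 * ((nbRad (d + 1) L : ℝ) + L) + 8 * (((d + 1 : ℕ) : ℝ) * L) + 2 * L) * (((d + 1 : ℕ) : ℝ) * (2 * nbRad (d + 1) L + 1) ^ (d + 1)))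
          / ((L : ℝ) / (L : ℝ) ^ (d + 1))))) * Cb + 768 * (((d + 1 : ℕ) : ℝ) + 1) * L * (3 + 12 * ((d + 1 : ℕ) : ℝ)) * Cb + 2 * |thetaLoc (d + 1) L| + 216 * Xs / lam + |cruxC (d + 1) L| + 6 * |C0 (d + 1)| + 1024 * (((d + 1 : ℕ) : ℝ) + 1) * (((d + 1 : ℕ) : ℝ) + 4) * (L : ℝ) ^ 2 + 1), div_pos one_pos hM, ?_⟩
  intro ε hε hεle
  have hεM : ε * (3 + 3 * Cb + 12 * (3 + 12 * ((d + 1 : ℕ) : ℝ)) ^ 2 * Cb / rho0 (d + 1) L ^ 2 + 3 * (8 * (3 + 12 * ((d + 1 : ℕ) : ℝ)) * (2 + 2 * ((((d + 1 : ℕ) : ℝ) + 1) * L)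
        * (1 + ((1250 * ((nbRad (d + 1) L : ℝ) + L) + 8 * (((d + 1 : ℕ) : ℝ) * L) + 2 * L) * (((d + 1 : ℕ) : ℝ) * (2 * nbRad (d + 1) L + 1) ^ (d + 1)))
          / ((L : ℝ) / (L : ℝ) ^ (d + 1))))) * Cb + 768 * (((d + 1 : ℕ) : ℝ) + 1) * L * (3 + 12 * ((d + 1 : ℕ) : ℝ)) * Cb + 2 * |thetaLoc (d + 1) L| + 216 * Xs / lam + |cruxC (d + 1) L| + 6 * |C0 (d + 1)| + 1024 * (((d + 1 : ℕ) : ℝ) + 1) * (((d + 1 : ℕ) : ℝ) + 4) * (L : ℝ) ^ 2 + 1) ≤ 1 := (le_div_iff₀ hM).mp hεle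
  have q2 : ε * (3) ≤ 1 :=
    (mul_le_mul_of_nonneg_left (show 3 ≤ (3 + 3 * Cb + 12 * (3 + 12 * ((d + 1 : ℕ) : ℝ)) ^ 2 * Cb / rho0 (d + 1) L ^ 2 + 3 * (8 * (3 + 12 * ((d + 1 : ℕ) : ℝ)) * (2 + 2 * ((((d + 1 : ℕ) : ℝ) + 1) * L)
        * (1 + ((1250 * ((nbRad (d + 1) L : ℝ) + L) + 8 * (((d + 1 : ℕ) : ℝ) * L) + 2 * L) * (((d + 1 : ℕ) : ℝ) * (2 * nbRad (d + 1) L + 1) ^ (d + 1)))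
          / ((L : ℝ) / (L : ℝ) ^ (d + 1))))) * Cb + 768 * (((d + 1 : ℕ) : ℝ) + 1) * L * (3 + 12 * ((d + 1 : ℕ) : ℝ)) * Cb + 2 * |thetaLoc (d + 1) L| + 216 * Xs / lam + |cruxC (d + 1) L| + 6 * |C0 (d + 1)| + 1024 * (((d + 1 : ℕ) : ℝ) + 1) * (((d + 1 : ℕ) : ℝ) + 4) * (L : ℝ) ^ 2 + 1) by linarith only [n2, nCb2, nρ, nKd, nD1, nθ, nX, ncx, nc0, nH2]) hε.le).trans hεM
  have qCb : ε * (3 * Cb) ≤ 1 :=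
    (mul_le_mul_of_nonneg_left (show 3 * Cb ≤ (3 + 3 * Cb + 12 * (3 + 12 * ((d + 1 : ℕ) : ℝ)) ^ 2 * Cb / rho0 (d + 1) L ^ 2 + 3 * (8 * (3 + 12 * ((d + 1 : ℕ) : ℝ)) * (2 + 2 * ((((d + 1 : ℕ) : ℝ) + 1) * L)
        * (1 + ((1250 * ((nbRad (d + 1) L : ℝ) + L) + 8 * (((d + 1 : ℕ) : ℝ) * L) + 2 * L) * (((d + 1 : ℕ) : ℝ) * (2 * nbRad (d + 1) L + 1) ^ (d + 1)))
          / ((L : ℝ) / (L : ℝ) ^ (d + 1))))) * Cb + 768 * (((d + 1 : ℕ) : ℝ) + 1) * L * (3 + 12 * ((d + 1 : ℕ) : ℝ)) * Cb + 2 * |thetaLoc (d + 1) L| + 216 * Xs / lam + |cruxC (d + 1) L| + 6 * |C0 (d + 1)| + 1024 * (((d + 1 : ℕ) : ℝ) + 1) * (((d + 1 : ℕ) : ℝ) + 4) * (L : ℝ) ^ 2 + 1) by linarith only [n2, nCb2, nρ, nKd, nD1, nθ, nX, ncx, nc0, nH2]) hε.le).trans hεM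
  have qρ : ε * (12 * (3 + 12 * ((d + 1 : ℕ) : ℝ)) ^ 2 * Cb / rho0 (d + 1) L ^ 2) ≤ 1 :=
    (mul_le_mul_of_nonneg_left (show 12 * (3 + 12 * ((d + 1 : ℕ) : ℝ)) ^ 2 * Cb / rho0 (d + 1) L ^ 2 ≤ (3 + 3 * Cb + 12 * (3 + 12 * ((d + 1 : ℕ) : ℝ)) ^ 2 * Cb / rho0 (d + 1) L ^ 2 + 3 * (8 * (3 + 12 * ((d + 1 : ℕ) : ℝ)) * (2 + 2 * ((((d + 1 : ℕ) : ℝ) + 1) * L)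
        * (1 + ((1250 * ((nbRad (d + 1) L : ℝ) + L) + 8 * (((d + 1 : ℕ) : ℝ) * L) + 2 * L) * (((d + 1 : ℕ) : ℝ) * (2 * nbRad (d + 1) L + 1) ^ (d + 1)))
          / ((L : ℝ) / (L : ℝ) ^ (d + 1))))) * Cb + 768 * (((d + 1 : ℕ) : ℝ) + 1) * L * (3 + 12 * ((d + 1 : ℕ) : ℝ)) * Cb + 2 * |thetaLoc (d + 1) L| + 216 * Xs / lam + |cruxC (d + 1) L| + 6 * |C0 (d + 1)| + 1024 * (((d + 1 : ℕ) : ℝ) + 1) * (((d + 1 : ℕ) : ℝ) + 4) * (L : ℝ) ^ 2 + 1) by linarith only [n2, nCb2, nρ, nKd, nD1, nθ, nX, ncx, nc0, nH2]) hε.le).trans hεM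
  have qKd : ε * (3 * (8 * (3 + 12 * ((d + 1 : ℕ) : ℝ)) * (2 + 2 * ((((d + 1 : ℕ) : ℝ) + 1) * L)
        * (1 + ((1250 * ((nbRad (d + 1) L : ℝ) + L) + 8 * (((d + 1 : ℕ) : ℝ) * L) + 2 * L) * (((d + 1 : ℕ) : ℝ) * (2 * nbRad (d + 1) L + 1) ^ (d + 1)))
          / ((L : ℝ) / (L : ℝ) ^ (d + 1))))) * Cb) ≤ 1 :=
    (mul_le_mul_of_nonneg_left (show 3 * (8 * (3 + 12 * ((d + 1 : ℕ) : ℝ)) * (2 + 2 * ((((d + 1 : ℕ) : ℝ) + 1) * L)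
        * (1 + ((1250 * ((nbRad (d + 1) L : ℝ) + L) + 8 * (((d + 1 : ℕ) : ℝ) * L) + 2 * L) * (((d + 1 : ℕ) : ℝ) * (2 * nbRad (d + 1) L + 1) ^ (d + 1)))
          / ((L : ℝ) / (L : ℝ) ^ (d + 1))))) * Cb ≤ (3 + 3 * Cb + 12 * (3 + 12 * ((d + 1 : ℕ) : ℝ)) ^ 2 * Cb / rho0 (d + 1) L ^ 2 + 3 * (8 * (3 + 12 * ((d + 1 : ℕ) : ℝ)) * (2 + 2 * ((((d + 1 : ℕ) : ℝ) + 1) * L)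
        * (1 + ((1250 * ((nbRad (d + 1) L : ℝ) + L) + 8 * (((d + 1 : ℕ) : ℝ) * L) + 2 * L) * (((d + 1 : ℕ) : ℝ) * (2 * nbRad (d + 1) L + 1) ^ (d + 1)))
          / ((L : ℝ) / (L : ℝ) ^ (d + 1))))) * Cb + 768 * (((d + 1 : ℕ) : ℝ) + 1) * L * (3 + 12 * ((d + 1 : ℕ) : ℝ)) * Cb + 2 * |thetaLoc (d + 1) L| + 216 * Xs / lam + |cruxC (d + 1) L| + 6 * |C0 (d + 1)| + 1024 * (((d + 1 : ℕ) : ℝ) + 1) * (((d + 1 : ℕ) : ℝ) + 4) * (L : ℝ) ^ 2 + 1) by linarith only [n2, nCb2, nρ, nKd, nD1, nθ, nX, ncx, nc0, nH2]) hε.le).trans hεM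
  have qD1 : ε * (768 * (((d + 1 : ℕ) : ℝ) + 1) * L * (3 + 12 * ((d + 1 : ℕ) : ℝ)) * Cb) ≤ 1 :=
    (mul_le_mul_of_nonneg_left (show 768 * (((d + 1 : ℕ) : ℝ) + 1) * L * (3 + 12 * ((d + 1 : ℕ) : ℝ)) * Cb ≤ (3 + 3 * Cb + 12 * (3 + 12 * ((d + 1 : ℕ) : ℝ)) ^ 2 * Cb / rho0 (d + 1) L ^ 2 + 3 * (8 * (3 + 12 * ((d + 1 : ℕ) : ℝ)) * (2 + 2 * ((((d + 1 : ℕ) : ℝ) + 1) * L)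
        * (1 + ((1250 * ((nbRad (d + 1) L : ℝ) + L) + 8 * (((d + 1 : ℕ) : ℝ) * L) + 2 * L) * (((d + 1 : ℕ) : ℝ) * (2 * nbRad (d + 1) L + 1) ^ (d + 1)))
          / ((L : ℝ) / (L : ℝ) ^ (d + 1))))) * Cb + 768 * (((d + 1 : ℕ) : ℝ) + 1) * L * (3 + 12 * ((d + 1 : ℕ) : ℝ)) * Cb + 2 * |thetaLoc (d + 1) L| + 216 * Xs / lam + |cruxC (d + 1) L| + 6 * |C0 (d + 1)| + 1024 * (((d + 1 : ℕ) : ℝ) + 1) * (((d + 1 : ℕ) : ℝ) + 4) * (L : ℝ) ^ 2 + 1) by linarith only [n2, nCb2, nρ, nKd, nD1, nθ, nX, ncx, nc0, nH2]) hε.le).trans hεM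
  have qθ : ε * (2 * |thetaLoc (d + 1) L|) ≤ 1 :=
    (mul_le_mul_of_nonneg_left (show 2 * |thetaLoc (d + 1) L| ≤ (3 + 3 * Cb + 12 * (3 + 12 * ((d + 1 : ℕ) : ℝ)) ^ 2 * Cb / rho0 (d + 1) L ^ 2 + 3 * (8 * (3 + 12 * ((d + 1 : ℕ) : ℝ)) * (2 + 2 * ((((d + 1 : ℕ) : ℝ) + 1) * L)
        * (1 + ((1250 * ((nbRad (d + 1) L : ℝ) + L) + 8 * (((d + 1 : ℕ) : ℝ) * L) + 2 * L) * (((d + 1 : ℕ) : ℝ) * (2 * nbRad (d + 1) L + 1) ^ (d + 1)))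
          / ((L : ℝ) / (L : ℝ) ^ (d + 1))))) * Cb + 768 * (((d + 1 : ℕ) : ℝ) + 1) * L * (3 + 12 * ((d + 1 : ℕ) : ℝ)) * Cb + 2 * |thetaLoc (d + 1) L| + 216 * Xs / lam + |cruxC (d + 1) L| + 6 * |C0 (d + 1)| + 1024 * (((d + 1 : ℕ) : ℝ) + 1) * (((d + 1 : ℕ) : ℝ) + 4) * (L : ℝ) ^ 2 + 1) by linarith only [n2, nCb2, nρ, nKd, nD1, nθ, nX, ncx, nc0, nH2]) hε.le).trans hεM
  have qX : ε * (216 * Xs / lam) ≤ 1 :=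
    (mul_le_mul_of_nonneg_left (show 216 * Xs / lam ≤ (3 + 3 * Cb + 12 * (3 + 12 * ((d + 1 : ℕ) : ℝ)) ^ 2 * Cb / rho0 (d + 1) L ^ 2 + 3 * (8 * (3 + 12 * ((d + 1 : ℕ) : ℝ)) * (2 + 2 * ((((d + 1 : ℕ) : ℝ) + 1) * L)
        * (1 + ((1250 * ((nbRad (d + 1) L : ℝ) + L) + 8 * (((d + 1 : ℕ) : ℝ) * L) + 2 * L) * (((d + 1 : ℕ) : ℝ) * (2 * nbRad (d + 1) L + 1) ^ (d + 1)))
          / ((L : ℝ) / (L : ℝ) ^ (d + 1))))) * Cb + 768 * (((d + 1 : ℕ) : ℝ) + 1) * L * (3 + 12 * ((d + 1 : ℕ) : ℝ)) * Cb + 2 * |thetaLoc (d + 1) L| + 216 * Xs / lam + |cruxC (d + 1) L| + 6 * |C0 (d + 1)| + 1024 * (((d + 1 : ℕ) : ℝ) + 1) * (((d + 1 : ℕ) : ℝ) + 4) * (L : ℝ) ^ 2 + 1) by linarith only [n2, nCb2, nρ, nKd, nD1, nθ, nX, ncx, nc0, nH2]) hε.le).trans hεM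
  have qcx : ε * (|cruxC (d + 1) L| + 1) ≤ 1 :=
    (mul_le_mul_of_nonneg_left (show |cruxC (d + 1) L| + 1 ≤ (3 + 3 * Cb + 12 * (3 + 12 * ((d + 1 : ℕ) : ℝ)) ^ 2 * Cb / rho0 (d + 1) L ^ 2 + 3 * (8 * (3 + 12 * ((d + 1 : ℕ) : ℝ)) * (2 + 2 * ((((d + 1 : ℕ) : ℝ) + 1) * L)
        * (1 + ((1250 * ((nbRad (d + 1) L : ℝ) + L) + 8 * (((d + 1 : ℕ) : ℝ) * L) + 2 * L) * (((d + 1 : ℕ) : ℝ) * (2 * nbRad (d + 1) L + 1) ^ (d + 1)))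
          / ((L : ℝ) / (L : ℝ) ^ (d + 1))))) * Cb + 768 * (((d + 1 : ℕ) : ℝ) + 1) * L * (3 + 12 * ((d + 1 : ℕ) : ℝ)) * Cb + 2 * |thetaLoc (d + 1) L| + 216 * Xs / lam + |cruxC (d + 1) L| + 6 * |C0 (d + 1)| + 1024 * (((d + 1 : ℕ) : ℝ) + 1) * (((d + 1 : ℕ) : ℝ) + 4) * (L : ℝ) ^ 2 + 1) by linarith only [n2, nCb2, nρ, nKd, nD1, nθ, nX, ncx, nc0, nH2]) hε.le).trans hεM
  have qc0 : ε * (6 * |C0 (d + 1)|) ≤ 1 :=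
    (mul_le_mul_of_nonneg_left (show 6 * |C0 (d + 1)| ≤ (3 + 3 * Cb + 12 * (3 + 12 * ((d + 1 : ℕ) : ℝ)) ^ 2 * Cb / rho0 (d + 1) L ^ 2 + 3 * (8 * (3 + 12 * ((d + 1 : ℕ) : ℝ)) * (2 + 2 * ((((d + 1 : ℕ) : ℝ) + 1) * L)
        * (1 + ((1250 * ((nbRad (d + 1) L : ℝ) + L) + 8 * (((d + 1 : ℕ) : ℝ) * L) + 2 * L) * (((d + 1 : ℕ) : ℝ) * (2 * nbRad (d + 1) L + 1) ^ (d + 1)))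
          / ((L : ℝ) / (L : ℝ) ^ (d + 1))))) * Cb + 768 * (((d + 1 : ℕ) : ℝ) + 1) * L * (3 + 12 * ((d + 1 : ℕ) : ℝ)) * Cb + 2 * |thetaLoc (d + 1) L| + 216 * Xs / lam + |cruxC (d + 1) L| + 6 * |C0 (d + 1)| + 1024 * (((d + 1 : ℕ) : ℝ) + 1) * (((d + 1 : ℕ) : ℝ) + 4) * (L : ℝ) ^ 2 + 1) by linarith only [n2, nCb2, nρ, nKd, nD1, nθ, nX, ncx, nc0, nH2]) hε.le).trans hεM
  have qH2 : ε * (1024 * (((d + 1 : ℕ) : ℝ) + 1) * (((d + 1 : ℕ) : ℝ) + 4) * (L : ℝ) ^ 2) ≤ 1 :=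
    (mul_le_mul_of_nonneg_left (show 1024 * (((d + 1 : ℕ) : ℝ) + 1) * (((d + 1 : ℕ) : ℝ) + 4) * (L : ℝ) ^ 2 ≤ (3 + 3 * Cb + 12 * (3 + 12 * ((d + 1 : ℕ) : ℝ)) ^ 2 * Cb / rho0 (d + 1) L ^ 2 + 3 * (8 * (3 + 12 * ((d + 1 : ℕ) : ℝ)) * (2 + 2 * ((((d + 1 : ℕ) : ℝ) + 1) * L)
        * (1 + ((1250 * ((nbRad (d + 1) L : ℝ) + L) + 8 * (((d + 1 : ℕ) : ℝ) * L) + 2 * L) * (((d + 1 : ℕ) : ℝ) * (2 * nbRad (d + 1) L + 1) ^ (d + 1)))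
          / ((L : ℝ) / (L : ℝ) ^ (d + 1))))) * Cb + 768 * (((d + 1 : ℕ) : ℝ) + 1) * L * (3 + 12 * ((d + 1 : ℕ) : ℝ)) * Cb + 2 * |thetaLoc (d + 1) L| + 216 * Xs / lam + |cruxC (d + 1) L| + 6 * |C0 (d + 1)| + 1024 * (((d + 1 : ℕ) : ℝ) + 1) * (((d + 1 : ℕ) : ℝ) + 4) * (L : ℝ) ^ 2 + 1) by linarith only [n2, nCb2, nρ, nKd, nD1, nθ, nX, ncx, nc0, nH2]) hε.le).trans hεM
  -- the scalar `ε`-conditions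
  have hε1' : ε ≤ 1 := by linarith only [q2, hε]
  have hle : 0 < lam * ε := mul_pos hl0 hε
  have hθabs : thetaLoc (d + 1) L * ε ≤ |thetaLoc (d + 1) L| * ε := mul_le_mul_of_nonneg_right (le_abs_self _) hε.le
  have hθhalf : thetaLoc (d + 1) L * ε ≤ 1 / 2 := by linarith only [hθabs, qθ]
  have hθl : thetaLoc (d + 1) L * ε < 1 := by linarith only [hθhalf]
  have hcrux : cruxC (d + 1) L * ε < 1 := by
    have h := mul_le_mul_of_nonneg_right (le_abs_self (cruxC (d + 1) L)) hε.le
    linarith only [h, qcx, hε]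
  have hε1 : 16 * C0 (d + 1) * ε ≤ 3 := by
    have h := mul_le_mul_of_nonneg_right (le_abs_self (C0 (d + 1))) hε.le
    linarith only [h, qc0]
  have hε2 : 1024 * (((d + 1 : ℕ) : ℝ) + 1) * (((d + 1 : ℕ) : ℝ) + 4) * (L : ℝ) ^ 2 * ε ≤ 1 := by linarith only [qH2]
  have hCc0 : (0 : ℝ) ≤ (curl1C (d + 1) L / (1 - thetaLoc (d + 1) L * ε)) := div_nonneg hcurl (by linarith only [hθhalf])
  have hCc : (curl1C (d + 1) L / (1 - thetaLoc (d + 1) L * ε)) ≤ (2 * curl1C (d + 1) L) := by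
    rw [div_le_iff₀ (by linarith only [hθhalf])]
    have h := mul_le_mul_of_nonneg_left (show (1 : ℝ) / 2 ≤ 1 - thetaLoc (d + 1) L * ε by linarith only [hθhalf]) hCcs0
    linarith only [h]
  -- `β₀ = log (1 + ε / (8 + 64·G_β))`
  have hden : (0 : ℝ) < 8 + 64 * G := by linarith only [hGB0]
  have hw0 : (0 : ℝ) < lam * ε / (8 + 64 * G) := div_pos hle hden
  refine ⟨Real.log (1 + lam * ε / (8 + 64 * G)), Real.log_pos (by linarith only [hw0]), ?_⟩
  intro β hβ hβle
  have hexp : Real.exp β ≤ 1 + lam * ε / (8 + 64 * G) := by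
    have h := Real.exp_le_exp.mpr hβle
    rwa [Real.exp_log (by linarith only [hw0])] at h
  have hw8 : lam * ε / (8 + 64 * G) * (8 + 64 * G) = lam * ε := div_mul_cancel₀ _ hden.ne'
  have hwnn : (0 : ℝ) ≤ G * (lam * ε / (8 + 64 * G)) := mul_nonneg hGB0 hw0.le
  have hlamε : lam * ε ≤ ε := (mul_lt_of_lt_one_left hε hl1).le
  have hβp0 : (0 : ℝ) ≤ (4 * (Real.exp β - 1)) := by have := Real.add_one_le_exp β; linarith only [this, hβ]
  have hβp1 : (4 * (Real.exp β - 1)) ≤ ε / 2 := by linarith only [hexp, hw8, hwnn, hlamε]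
  have hβp2 : 16 * G * (4 * (Real.exp β - 1)) ≤ lam * ε := by
    have h := mul_le_mul_of_nonneg_left (show Real.exp β - 1 ≤ lam * ε / (8 + 64 * G) by linarith only [hexp]) hGB0
    linarith only [h, hw8, hw0]
  have hT0 : (0 : ℝ) ≤ (lam * ε + 4 * (Real.exp β - 1) + ε) := by linarith only [hle, hε, hβp0]
  have hT2 : (lam * ε + 4 * (Real.exp β - 1) + ε) ≤ 3 * ε := by linarith only [hβp1, hlamε, hε.le]
  have hT1 : (lam * ε + 4 * (Real.exp β - 1) + ε) ≤ 1 := by linarith only [hT2, q2]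
  -- the datum of constants
  intro N _ Kc CP C₀ C₁ αh νh κh hN hKc hCP hls 𝒯 hT hP hline hC₀ hC₀b' hC₁ hC₁b'
  have hC₀b : C₀ ≤ Cb := by rw [hCb]; exact hC₀b'.trans (le_add_of_nonneg_right zero_le_one)
  have hC₁b : C₁ ≤ Cb := by rw [hCb]; exact hC₁b'.trans (le_add_of_nonneg_right zero_le_one)
  have hC₀T : C₀ * (lam * ε + 4 * (Real.exp β - 1) + ε) ≤ Cb * (3 * ε) := mul_le_mul hC₀b hT2 hT0 hCb0
  have hC₀T1 : C₀ * (lam * ε + 4 * (Real.exp β - 1) + ε) ≤ 1 := by linarith only [hC₀T, qCb]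
  have hF51a : 4 * (3 + 12 * ((d + 1 : ℕ) : ℝ)) ^ 2 * (C₀ * (lam * ε + 4 * (Real.exp β - 1) + ε)) ≤ rho0 (d + 1) L ^ 2 := by
    have e : 12 * (3 + 12 * ((d + 1 : ℕ) : ℝ)) ^ 2 * Cb / rho0 (d + 1) L ^ 2 * rho0 (d + 1) L ^ 2 = 12 * (3 + 12 * ((d + 1 : ℕ) : ℝ)) ^ 2 * Cb := div_mul_cancel₀ _ (pow_ne_zero 2 hρ.ne')
    have h := mul_le_mul_of_nonneg_right qρ (sq_nonneg (rho0 (d + 1) L))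
    rw [mul_assoc, e, one_mul] at h
    have g := mul_le_mul_of_nonneg_left hC₀T (mul_nonneg (by norm_num : (0:ℝ) ≤ 4) (sq_nonneg ((3 + 12 * ((d + 1 : ℕ) : ℝ)))))
    linarith only [h, g]
  have hF51b : (8 * (3 + 12 * ((d + 1 : ℕ) : ℝ)) * (2 + 2 * ((((d + 1 : ℕ) : ℝ) + 1) * L)
        * (1 + ((1250 * ((nbRad (d + 1) L : ℝ) + L) + 8 * (((d + 1 : ℕ) : ℝ) * L) + 2 * L) * (((d + 1 : ℕ) : ℝ) * (2 * nbRad (d + 1) L + 1) ^ (d + 1)))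
          / ((L : ℝ) / (L : ℝ) ^ (d + 1))))) * (C₀ * (lam * ε + 4 * (Real.exp β - 1) + ε)) ≤ 1 := by
    have g := mul_le_mul_of_nonneg_left hC₀T hKd0
    linarith only [g, qKd]
  have hF51c : 256 * (((d + 1 : ℕ) : ℝ) + 1) * L * (3 + 12 * ((d + 1 : ℕ) : ℝ)) * (C₀ * (lam * ε + 4 * (Real.exp β - 1) + ε)) ≤ 1 := by
    have g := mul_le_mul_of_nonneg_left hC₀T (mul_nonneg (mul_nonneg (mul_nonneg (by norm_num : (0:ℝ) ≤ 256) hD10) hL0) hK30)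
    linarith only [g, qD1]
  -- the budget: `T·X + ec·Y + ek·Z ≤ 1/24`
  have hTX : (lam * ε + 4 * (Real.exp β - 1) + ε) * Xs ≤ lam / 72 := by
    have g := mul_le_mul_of_nonneg_right hT2 hXs0
    have e : 216 * Xs / lam * lam = 216 * Xs := div_mul_cancel₀ _ hl0.ne'
    have q := mul_le_mul_of_nonneg_right qX hl0.le
    rw [mul_assoc, e, one_mul] at q
    linarith only [g, q]
  have hS0 : (lam * ε + 4 * (Real.exp β - 1) + ε) * Xs + Real.exp (-(c * ℓ)) * (K * (2 * curl1C (d + 1) L) + 8 * K * (Fintype.card (T4AveragingDeficitWall.Plane (d + 1)) : ℝ) * Cb) + Real.exp (-(kappa163 (d + 1) / (d + 1) / 2 * ℓ)) * Z ≤ lam / 24 := by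
    linarith only [hTX, hYx, hZx]
  have hS := hS0
  rw [hXs, hZ] at hS
  have hS1 := hS.trans (show lam / 24 ≤ 1 / 24 by linarith only [hl1])
  have hβp2' := hβp2
  rw [hG] at hβp2'
  have hBR := budgetR_of_regime (K := K) (ec := Real.exp (-(c * ℓ))) (ek := Real.exp (-(kappa163 (d + 1) / (d + 1) / 2 * ℓ))) (Cc := (curl1C (d + 1) L / (1 - thetaLoc (d + 1) L * ε))) (Cc' := (2 * curl1C (d + 1) L)) (Kd := (8 * (3 + 12 * ((d + 1 : ℕ) : ℝ)) * (2 + 2 * ((((d + 1 : ℕ) : ℝ) + 1) * L)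
        * (1 + ((1250 * ((nbRad (d + 1) L : ℝ) + L) + 8 * (((d + 1 : ℕ) : ℝ) * L) + 2 * L) * (((d + 1 : ℕ) : ℝ) * (2 * nbRad (d + 1) L + 1) ^ (d + 1)))
          / ((L : ℝ) / (L : ℝ) ^ (d + 1)))))) (cP := (Fintype.card (T4AveragingDeficitWall.Plane (d + 1)) : ℝ))
    (Cg := (2 * (CdecD d * (((d : ℝ) + 1) * (2 * ((d : ℝ) + 1))
              * ((2 + 32 / (kappa163 (d + 1) / (d + 1)) ^ 2) * latticeConst (d + 1) (kappa163 (d + 1) / (d + 1) / 2)))))) (D := ((d : ℝ) + 1)) (K₃ := (3 + 12 * ((d + 1 : ℕ) : ℝ))) (K₄ := (4 * (3 + 12 * ((d + 1 : ℕ) : ℝ)) ^ 3 / rho0 (d + 1) L ^ 2)) (Cd := CdecD d) (lc := latticeConst (d + 1) (kappa163 (d + 1) / (d + 1) / 2)) (lq := (4 * ((ℓ + 1 : ℕ) : ℝ) + 2)) (nF := (Fintype.card n : ℝ)) (C₀ := C₀) (C₁ := C₁)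
    (Cb := Cb) (T := (lam * ε + 4 * (Real.exp β - 1) + ε)) hK hec0 hec1 hek0 hCc0 hCc hKd0 hcP0 hCg0 hD0 hK30 hK40 hCd0 hlc0 hlq0 hnF0 hT0 hT1 hC₀ hC₀b hC₁ hC₁b hCb1 hS1
  have hBC := budgetC_of_regime_ratio (K := K) (ec := Real.exp (-(c * ℓ))) (ek := Real.exp (-(kappa163 (d + 1) / (d + 1) / 2 * ℓ))) (Cc := (curl1C (d + 1) L / (1 - thetaLoc (d + 1) L * ε))) (Cc' := (2 * curl1C (d + 1) L)) (Kd := (8 * (3 + 12 * ((d + 1 : ℕ) : ℝ)) * (2 + 2 * ((((d + 1 : ℕ) : ℝ) + 1) * L)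
        * (1 + ((1250 * ((nbRad (d + 1) L : ℝ) + L) + 8 * (((d + 1 : ℕ) : ℝ) * L) + 2 * L) * (((d + 1 : ℕ) : ℝ) * (2 * nbRad (d + 1) L + 1) ^ (d + 1)))
          / ((L : ℝ) / (L : ℝ) ^ (d + 1)))))) (cP := (Fintype.card (T4AveragingDeficitWall.Plane (d + 1)) : ℝ))
    (Cg := (2 * (CdecD d * (((d : ℝ) + 1) * (2 * ((d : ℝ) + 1))
              * ((2 + 32 / (kappa163 (d + 1) / (d + 1)) ^ 2) * latticeConst (d + 1) (kappa163 (d + 1) / (d + 1) / 2)))))) (D := ((d : ℝ) + 1)) (K₃ := (3 + 12 * ((d + 1 : ℕ) : ℝ))) (K₄ := (4 * (3 + 12 * ((d + 1 : ℕ) : ℝ)) ^ 3 / rho0 (d + 1) L ^ 2)) (Cd := CdecD d) (lc := latticeConst (d + 1) (kappa163 (d + 1) / (d + 1) / 2)) (lq := (4 * ((ℓ + 1 : ℕ) : ℝ) + 2)) (nF := (Fintype.card n : ℝ)) (C₀ := C₀) (C₁ := C₁)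
    (Cb := Cb) (T := (lam * ε + 4 * (Real.exp β - 1) + ε)) (βp := (4 * (Real.exp β - 1))) (ε := ε) (lam := lam) hK hec0 hec1 hek0 hek1 hCc0 hCc hKd0 hcP0 hCg0 hD0 hK30 hK40 hCd0 hlc0 hlq0
    hnF0 hT0 hT1 hC₀ hC₀b hC₁ hC₁b hCb1 hl0.le hε.le hβp0 hβp1 hβp2' hS
  intro hchart hdecomp
  exact hF N ℓ Kc ε (lam * ε) (lam * ε / 2) CP β (lam * ε / 4) (1 / 4) C₀ C₁ αh νh κh hN hε hε1 hε2
    (by linarith only [hle]) (by linarith only [hle]) (mul_lt_of_lt_one_left hε hl1) hCP hβ hls 𝒯 hT hP hθl hε1'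
    hline hℓ1 hKc (by linarith only [hle]) (by norm_num) (by norm_num) (by linarith only [hle])
    (by rw [div_lt_iff₀ (by norm_num : (0:ℝ) < 1 - 1 / 4)]; linarith only [hle]) hcrux hC₀ hC₁ hF51a hF51b hF51c hC₀T1
    hBR hBC hchart hdecomp

end Summit.QuantumFields.BalabanUV.T4Continuum.NE7OneStepOfLocalChartRatioWideDecSlice
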